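import Summits.ValiantsHypothesis.ValiantsHypothesis.Theorems.KPlusLogSqLawTropicalBSymmetry

/-!
# Route `KPlusLogSqLaw`, crux `TropicalB` — the Toeplitz sector: dominant permutations have unshared displacement profiles

HONEST FRAMING.  Helper file for the crux `Summit.ValiantsHypothesis.ValiantsHypothesis.Theses.KPlusLogSqLaw.TropicalB`
(ledger item `stmt-ValiantsHypothesis-19771`; cell `pub-symmetroid`, seat `val-sym-trop-p2`, 2026-08-26).  Nothing here
proves the registered stub `stub_tropFat`; nothing asserts `TropicalB`, `KPlusLogSqLaw`, `MatrixDescartes` or anything about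
`VP ≠ VNP`.

THE SECTOR.  A design of format `(m, K)` is TOEPLITZ when its valuations and its presence/sign pattern depend only on the
integer difference `a − b ∈ ℤ` of the entry `(a, b)` (row minus column; it encodes the cyclic shift AND the wrap bit) and on
the class: `v a b l = f (a − b) l`, `ε a b l = g (a − b) l`.  This sector is NOT permutation-poor: it contains the cell's
`m`-phase PERMUTATION REGISTER (SHIFT-THREE, `…TropicalShiftThree`, minus its symmetry-breaking column price has all `m`
rotations as dominant permutations) and, by exact enumeration (seat memo `HOME/val-sym-trop-p2/REGISTERS.md`, bus
2026-08-26T05:40Z), `≈ 2.4^m` permutations of `Fin m` with an unshared displacement profile — the candidates allowed by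
the theorem below.

WHAT IS HERE (the kernel form of step (a) of the seat's Toeplitz reduction).
* `tropWeight_transport_toeplitz`, `termSign_transport_toeplitz_ne_zero` — in a Toeplitz design, transporting the class map
  of a term `(σ, λ)` along a bijection `β` of the columns that preserves displacements (`σ' (β b) − β b = σ b − b`) to the
  permutation `σ'` gives a term `(σ', λ ∘ β⁻¹)` with the same tropical weight at every slope and the same presence.
* `toeplitz_dominant_eq_of_transport` — hence (no ties at the top, `eq_of_isDominant`) a DOMINANT term admits no such
  transport other than the identity: `σ' = σ`.
* `toeplitz_dominant_perm_unique_profile` — **a dominant permutation of a Toeplitz design has a displacement profile shared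
  with no other permutation**: if `σ'` has the same multiset of displacements `{σ' b − b} = {σ b − b}` then `σ' = σ` (glue
  fibrewise bijections into a displacement-preserving `β`, `Equiv.ofFiberEquiv`).
Consequence on paper (not formalised here): on each of the `≤ (2m−1)(K−1)+1` slope intervals where every diagonal's best
class is fixed, the dominant terms of a Toeplitz design are the unique optima of a LINEAR Toeplitz parametric assignment,
i.e. upper-hull vertices with a unique preimage of a plane shadow of the displacement-profile polytope
`conv{(#{b : σ b − b = δ})_δ}`; the seat's exact data (`m ≤ 8`) fit `4m − 7` such vertices at most (Conjecture T of the memo,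
OPEN), which would make the Toeplitz sector obey `T = O(m² K)` in the window.  Nothing of that is claimed here.

References: folklore (transport of structure); `eq_of_isDominant` (`…TropicalBSymmetry`); the fibre-gluing lemma is the
8-line folklore argument also used in `Literature/AlgebraicGeometry/HodgeTheory/FermatClaimPermutationInvariance.lean`
(`exists_perm_eq_comp_of_univ_val_map_eq`), re-proved here for `ℤ`-valued displacement maps to avoid a Hodge-theory import.
-/

set_option linter.dupNamespace false
set_option autoImplicit false

namespace Summit.ValiantsHypothesis.ValiantsHypothesis.Theorems.KPlusLogSqLaw

open Summit.ValiantsHypothesis.ValiantsHypothesis.Theorems.MatrixDescartes.Negative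
open scoped BigOperators
open Finset

section Toeplitz

variable {m K : ℕ}

/-- **Weight transport in a Toeplitz design.**  If `β` is a bijection of the columns with `σ' (β b) − β b = σ b − b` for all
`b`, then the term `(σ', λ ∘ β⁻¹)` has the same tropical weight as `(σ, λ)` at every slope. [folklore] -/
theorem tropWeight_transport_toeplitz (d : Fin K → ℕ) (f : ℤ → Fin K → ℤ) (θ : ℤ) (σ σ' β : Equiv.Perm (Fin m))
    (μ : Fin m → Fin K) (hβ : ∀ b, (σ' (β b) : ℤ) - (β b : ℤ) = (σ b : ℤ) - (b : ℤ)) :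
    tropWeight d (fun a b l => f ((a : ℤ) - b) l) θ (σ', fun j => μ (β.symm j)) =
      tropWeight d (fun a b l => f ((a : ℤ) - b) l) θ (σ, μ) := by
  unfold tropWeight
  dsimp only
  have h1 : ∑ j, (d (μ (β.symm j)) : ℤ) = ∑ b, (d (μ b) : ℤ) := Equiv.sum_comp β.symm (fun b => (d (μ b) : ℤ))
  have h2 : ∑ j, f ((σ' j : ℤ) - j) (μ (β.symm j)) = ∑ b, f ((σ b : ℤ) - b) (μ b) := by
    rw [← Equiv.sum_comp β (fun j => f ((σ' j : ℤ) - j) (μ (β.symm j)))]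
    refine sum_congr rfl fun b _ => ?_
    simp only [Equiv.symm_apply_apply]
    rw [hβ b]
  rw [h1, h2]

/-- **Presence transport in a Toeplitz design**: the transported term is present if the original one is. [folklore] -/
theorem termSign_transport_toeplitz_ne_zero (g : ℤ → Fin K → ℤ) (σ σ' β : Equiv.Perm (Fin m)) (μ : Fin m → Fin K)
    (hβ : ∀ b, (σ' (β b) : ℤ) - (β b : ℤ) = (σ b : ℤ) - (b : ℤ))
    (h : termSign (fun a b l => g ((a : ℤ) - b) l) (σ, μ) ≠ 0) :
    termSign (fun a b l => g ((a : ℤ) - b) l) (σ', fun j => μ (β.symm j)) ≠ 0 := by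
  unfold termSign at *
  dsimp only at *
  have h2 : ∏ j, g ((σ' j : ℤ) - j) (μ (β.symm j)) = ∏ b, g ((σ b : ℤ) - b) (μ b) := by
    rw [← Equiv.prod_comp β (fun j => g ((σ' j : ℤ) - j) (μ (β.symm j)))]
    refine prod_congr rfl fun b _ => ?_
    simp only [Equiv.symm_apply_apply]
    rw [hβ b]
  rw [h2]
  exact mul_ne_zero (Units.ne_zero _) (mul_ne_zero_iff.mp h).2

/-- **No transport of a dominant term.**  In a Toeplitz design, if `(σ, λ)` is dominant at `θ` and `β` is a
displacement-preserving bijection of the columns towards `σ'` (`σ' (β b) − β b = σ b − b`), then `σ' = σ` (and the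
transported class map is `λ`): the transported term ties with the dominant one, so it IS the dominant one. [folklore] -/
theorem toeplitz_dominant_eq_of_transport (d : Fin K → ℕ) (f g : ℤ → Fin K → ℤ) (θ : ℤ) (σ σ' β : Equiv.Perm (Fin m))
    (μ : Fin m → Fin K) (hβ : ∀ b, (σ' (β b) : ℤ) - (β b : ℤ) = (σ b : ℤ) - (b : ℤ))
    (hp : IsDominant d (fun a b l => f ((a : ℤ) - b) l) (fun a b l => g ((a : ℤ) - b) l) θ (σ, μ)) :
    (σ', fun j => μ (β.symm j)) = (σ, μ) :=
  eq_of_isDominant d _ _ θ hp (termSign_transport_toeplitz_ne_zero g σ σ' β μ hβ hp.1)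
    (le_of_eq (tropWeight_transport_toeplitz d f θ σ σ' β μ hβ).symm)

/-- multiplicity of a displacement value = cardinality of its fibre [folklore] -/
private theorem card_fibre_eq_count (σ : Equiv.Perm (Fin m)) (c : ℤ) :
    Fintype.card {b // (σ b : ℤ) - (b : ℤ) = c} = Multiset.count c (univ.val.map fun b => (σ b : ℤ) - (b : ℤ)) := by
  rw [Fintype.card_subtype, Multiset.count_map, ← Finset.filter_val, Finset.card_val]
  congr 1
  exact Finset.filter_congr fun i _ => eq_comm

/-- Two permutations with the same MULTISET of displacements are related by a displacement-preserving bijection of the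
columns (glue bijections between the equal-size fibres). [folklore] -/
theorem exists_transport_of_displacements_eq (σ σ' : Equiv.Perm (Fin m))
    (h : univ.val.map (fun b => (σ' b : ℤ) - (b : ℤ)) = univ.val.map (fun b => (σ b : ℤ) - (b : ℤ))) :
    ∃ β : Equiv.Perm (Fin m), ∀ b, (σ' (β b) : ℤ) - (β b : ℤ) = (σ b : ℤ) - (b : ℤ) := by
  have e : ∀ c : ℤ, {b // (σ b : ℤ) - (b : ℤ) = c} ≃ {b // (σ' b : ℤ) - (b : ℤ) = c} := fun c =>
    Fintype.equivOfCardEq (by rw [card_fibre_eq_count, card_fibre_eq_count, h])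
  exact ⟨Equiv.ofFiberEquiv e, fun b => Equiv.ofFiberEquiv_map e b⟩

/-- **Toeplitz sector: a dominant permutation has an unshared displacement profile.**  If the valuations and the presence
pattern of a design depend only on `a − b ∈ ℤ` and the class, `(σ, λ)` is dominant at some slope, and `σ'` has the same
multiset of displacements `{σ' b − b}_b = {σ b − b}_b`, then `σ' = σ`.  (So the dominant permutations of a Toeplitz design are
among the permutations determined by their displacement multiset; plane shadows of the displacement-profile polytope bound the
rest — see the module docstring.) [folklore] -/
theorem toeplitz_dominant_perm_unique_profile (d : Fin K → ℕ) (f g : ℤ → Fin K → ℤ) (θ : ℤ) (σ σ' : Equiv.Perm (Fin m))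
    (μ : Fin m → Fin K)
    (hp : IsDominant d (fun a b l => f ((a : ℤ) - b) l) (fun a b l => g ((a : ℤ) - b) l) θ (σ, μ))
    (h : univ.val.map (fun b => (σ' b : ℤ) - (b : ℤ)) = univ.val.map (fun b => (σ b : ℤ) - (b : ℤ))) : σ' = σ := by
  obtain ⟨β, hβ⟩ := exists_transport_of_displacements_eq σ σ' h
  exact (Prod.mk.inj (toeplitz_dominant_eq_of_transport d f g θ σ σ' β μ hβ hp)).1

end Toeplitz

end Summit.ValiantsHypothesis.ValiantsHypothesis.Theorems.KPlusLogSqLaw
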